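import Summits.AnomalousDissipation.AnomalousDissipation.Theorems.SolenoidalFractalHomogenisationLagrangianCarrierAnalyticFlow
import Summits.AnomalousDissipation.AnomalousDissipation.Theorems.SolenoidalFractalHomogenisationLagrangianCarrierAnalyticLevel
import Literature.Analysis.FunctionSpaces.TorusAnalyticSeminormShift
import Literature.Analysis.FunctionSpaces.TorusAnalyticCompositionProof
import Literature.Analysis.FunctionSpaces.TorusAnalyticProduct
import HarnessLib

/-!
# Analytic tower of a Lagrangian lattice carrier, III: the LEVEL STEP — analyticity of `b (i+2)` from analyticity of
# `b 1, …, b (i+1)` (helper for K1L_D `stmt-AnomalousDissipation-27980`, W3-E (ii) `stub_effectiveFrameEnergyL_bandKill`; `--supports`)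

Summits-side helper file (everything proved; no definitions, no named facts). One step of the induction on levels (Armstrong–Vicol
App. A run on the Lagrangian insertion of §2.2): if every coarse level `b (j+1)`, `j ≤ i`, has componentwise seminorms
`⟦b (j+1) t⟧_{n, ρⱼ N_{j+1}} ≤ C_b a_{j+1}/N_{j+1}` (all `n`, `t`; `λ_W ≤ ρⱼ ≤ ρᵢ`), and the strain ceiling
`strain (i+1) ≤ 1/(36 C_b ρᵢ)` holds, then the next level — the Eulerian level `level (i+2)` pushed forward by the window flow of
`b_{≤ i+1}` (`IsInserted`) — satisfies `⟦b (i+2) t⟧_{n, 13248 ρᵢ N_{i+1} + 183 λ_W N_{i+2}} ≤ C_b a_{i+2}/N_{i+2}` with the SAME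
amplitude constant `C_b = 216 · (9/2) k/(2π)`: the flow-gradient entries have seminorms `≤ 18` at radius `72 ρᵢ N_{i+1}` (Prop. 7.11,
`…AnalyticFlow`), the product with the level (Lemma 7.1, constant `4`) costs `4 · 18 · 3`, and composition with the inverse window flow
(Prop. 7.6, `TorusAnalyticCompositionProof`) keeps the constant and moves the radius to `R_g(1 + 3 C_g R_h)`, `C_g R_g = 61`.
Infrastructure for route-1's rung leaf F-D1.A0 (a frontier FORMAL rung); NOT a proof of anomalous dissipation.
-/

set_option linter.dupNamespace false

noncomputable section

namespace Summit.AnomalousDissipation.AnomalousDissipation.Theorems.SolenoidalFractalHomogenisation.LagrangianCarrierAnalytic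

open Set Function Filter Topology
open scoped ContDiff
open Literature.Analysis Literature.Analysis.ODE
open Literature.Analysis.FunctionSpaces Literature.Analysis.FunctionSpaces.Torus
open Literature.Analysis.FluidPDE Literature.Analysis.FluidPDE.LatticeShear

variable {k : ℕ}

/-! ## §1 The pushed-forward level in coordinates -/

/-- `flowDeriv` is linear: `DX(y) v = Σ_b v_b · DX(y) e_b`. [folklore] -/
private theorem flowDeriv_apply_eq_sum' (E : LagrangianLatticeCarrier k) (m : ℕ) (t s : ℝ) (y : UnitAddTorus (Fin 3))
    (v : EuclideanSpace ℝ (Fin 3)) :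
    E.flowDeriv m t s y v = ∑ a, v a • E.flowDeriv m t s y (EuclideanSpace.single a (1 : ℝ)) := by
  conv_lhs => rw [← (EuclideanSpace.basisFun (Fin 3) ℝ).sum_repr v]
  simp only [map_sum, map_smul, EuclideanSpace.basisFun_apply, EuclideanSpace.basisFun_repr]

/-- **The inserted level as a composition**: on the window `j` of level `m+1` (`w` its left end),
`b (m+1) t x = F(x + proj Dinv(x))` with `F(y) = flowDeriv m t w y (level (m+1) t y)` and `Dinv = disp m w t` (the inverse window flow).
[cite: ArmstrongVicol2025, §2.2 (PDF p. 18: b_m inserted in the Lagrangian coordinates of b_{m−1})] -/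
theorem b_succ_eq_comp_inv (E : LagrangianLatticeCarrier k) (hL : E.IsLagrangian) (hR : E.LevelRegular) (m : ℕ) (j : ℤ) {t : ℝ}
    (ht : t ∈ E.window (m + 1) j) (x : UnitAddTorus (Fin 3)) :
    E.b (m + 1) t x = E.flowDeriv m t ((j : ℝ) * E.refresh (m + 1)) (x + proj (E.disp m ((j : ℝ) * E.refresh (m + 1)) t x))
      (E.toFractalCarrierData.level (m + 1) t (x + proj (E.disp m ((j : ℝ) * E.refresh (m + 1)) t x))) := by
  have hy : E.X m t ((j : ℝ) * E.refresh (m + 1)) (E.X m ((j : ℝ) * E.refresh (m + 1)) t x) = x := by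
    have h := congrFun (hR.X_comp_X m t ((j : ℝ) * E.refresh (m + 1)) t) x
    rw [hR.X_self] at h
    exact h
  have hins := (hL m).2 j t ht (E.X m ((j : ℝ) * E.refresh (m + 1)) t x)
  rw [hy] at hins
  rw [hins]
  rfl

/-- Coordinate form: `b (m+1) t x c = Σ_b J_{cb}(y) v_b(y)`, `y = x + proj Dinv(x)`, `J_{cb}(y) = (flowDeriv m t w y e_b)_c`, `v = level (m+1) t`.
[cite: ArmstrongVicol2025, §2.2 (PDF p. 18)] -/
theorem b_succ_apply_eq_sum (E : LagrangianLatticeCarrier k) (hL : E.IsLagrangian) (hR : E.LevelRegular) (m : ℕ) (j : ℤ) {t : ℝ}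
    (ht : t ∈ E.window (m + 1) j) (x : UnitAddTorus (Fin 3)) (c : Fin 3) :
    E.b (m + 1) t x c =
      (fun y => ∑ b : Fin 3, (E.flowDeriv m t ((j : ℝ) * E.refresh (m + 1)) y (EuclideanSpace.single b (1 : ℝ))) c *
        E.toFractalCarrierData.level (m + 1) t y b) (x + proj (E.disp m ((j : ℝ) * E.refresh (m + 1)) t x)) := by
  rw [b_succ_eq_comp_inv E hL hR m j ht x]
  simp only
  rw [flowDeriv_apply_eq_sum']
  rw [WithLp.ofLp_sum, Finset.sum_apply]
  refine Finset.sum_congr rfl fun b _ => ?_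
  rw [WithLp.ofLp_smul, Pi.smul_apply, smul_eq_mul, mul_comm]

/-! ## §2 Small tools -/

/-- `N` is monotone along the cascade (`2 N_m ≤ N_{m+1}`). [cite: ArmstrongVicol2025, §3 (3.42)–(3.43)] -/
theorem N_mono (E : LagrangianLatticeCarrier k) (hN2 : ∀ m, 2 * E.N m ≤ E.N (m + 1)) {a b : ℕ} (hab : a ≤ b) :
    E.N a ≤ E.N b :=
  (monotone_nat_of_le_succ fun m => (Nat.le_mul_of_pos_left (E.N m) (by norm_num : 0 < 2)).trans (hN2 m)) hab

/-- Subadditivity of the seminorms over finite sums (vector-valued). [cite: ArmstrongVicol2025, App. A (A.1)] -/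
theorem dnorm_finset_sum_le_vec {ι : Type*} {F : Type*} [NormedAddCommGroup F] [NormedSpace ℝ F] (s : Finset ι) (n : ℕ)
    {R : ℝ} (hR : 0 < R) {G : ι → UnitAddTorus (Fin 3) → F} (hG : ∀ a ∈ s, IsSmooth (G a)) :
    dnorm n R (fun y => ∑ a ∈ s, G a y) ≤ ∑ a ∈ s, dnorm n R (G a) := by
  classical
  induction s using Finset.induction_on with
  | empty =>
    simp only [Finset.sum_empty]
    rcases Nat.eq_zero_or_pos n with rfl | hn
    · exact dnorm_zero_le_of_forall_norm_le hR le_rfl fun y => by simp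
    · exact (dnorm_const_eq_zero hn R (0 : F)).le
  | insert a s ha ih =>
    have hGa : IsSmooth (G a) := hG a (Finset.mem_insert_self a s)
    have hGs : ∀ b ∈ s, IsSmooth (G b) := fun b hb => hG b (Finset.mem_insert_of_mem hb)
    have hsm : IsSmooth (fun y => ∑ b ∈ s, G b y) := by
      show ContDiff ℝ ∞ (lift fun y => ∑ b ∈ s, G b y)
      have e : (lift fun y => ∑ b ∈ s, G b y) = fun z => ∑ b ∈ s, lift (G b) z := by funext z; simp [lift_apply]
      rw [e]; exact ContDiff.sum fun b hb => hGs b hb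
    simp only [Finset.sum_insert ha]
    exact (dnorm_add_le n hR hGa hsm).trans (add_le_add le_rfl (ih hGs))

/-- `‖v‖ ≤ Σᵢ |vᵢ|` in `ℝ³`. [folklore] -/
private theorem norm_le_sum_abs_coord₃ (v : EuclideanSpace ℝ (Fin 3)) : ‖v‖ ≤ ∑ i, |v i| := by
  conv_lhs => rw [← (EuclideanSpace.basisFun (Fin 3) ℝ).sum_repr v]
  refine (norm_sum_le _ _).trans (Finset.sum_le_sum fun i _ => ?_)
  rw [EuclideanSpace.basisFun_repr, norm_smul, Real.norm_eq_abs, EuclideanSpace.basisFun_apply,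
    PiLp.norm_single, norm_one, mul_one]

/-! ## §3 The coarse field at the common radius and the window time -/

/-- **The coarse field at the common radius.** If `⟦(b (j+1) t)_c⟧_{n, ρ j N (j+1)} ≤ C_b a_{j+1}/N_{j+1}` for `j ≤ i` with
`0 < ρ j ≤ ρ i`, then for `n ≥ 1`: `⟦b_{≤ i+1}(t)⟧_{n, ρ i N (i+1)} ≤ 3 C_b (Σ_{j ≤ i} a_{j+1}) / N_{i+1}` (enlarging the radius gains
`N_{j+1}/N_{i+1}` at order `≥ 1`). [cite: ArmstrongVicol2025, App. A (A.1); §2.2] -/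
theorem dnorm_partialSum_le (E : LagrangianLatticeCarrier k) (hR : E.LevelRegular) (hN2 : ∀ m, 2 * E.N m ≤ E.N (m + 1)) (i : ℕ)
    (ρ : ℕ → ℝ) (hρ0 : ∀ j, 0 < ρ j) (hρmono : ∀ j, j ≤ i → ρ j ≤ ρ i) {Cb : ℝ}
    (hIH : ∀ j, j ≤ i → ∀ (t : ℝ) (c : Fin 3) (n : ℕ),
      dnorm n (ρ j * E.N (j + 1)) (fun x => E.b (j + 1) t x c) ≤ Cb * E.a (j + 1) / E.N (j + 1))
    {n : ℕ} (hn : 1 ≤ n) (t : ℝ) :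
    dnorm n (ρ i * E.N (i + 1)) (E.partialSum (i + 1) t) ≤ 3 * Cb * (∑ j ∈ Finset.range (i + 1), E.a (j + 1)) / E.N (i + 1) := by
  have hN : ∀ m, (0 : ℝ) < E.N m := fun m => by exact_mod_cast E.N_pos m
  have hRf0 : 0 < ρ i * E.N (i + 1) := mul_pos (hρ0 i) (hN _)
  have hsm : ∀ j ∈ Finset.range (i + 1), IsSmooth (E.b (j + 1) t) := fun j _ => hR.isSmooth_b j t
  have hcomp : ∀ j ∈ Finset.range (i + 1), ∀ c' : Fin 3,
      dnorm n (ρ i * E.N (i + 1)) (fun x => E.b (j + 1) t x c') ≤ Cb * E.a (j + 1) / E.N (i + 1) := by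
    intro j hj c'
    have hji : j ≤ i := Nat.lt_succ_iff.mp (Finset.mem_range.mp hj)
    have hRj : 0 < ρ j * E.N (j + 1) := mul_pos (hρ0 j) (hN _)
    have hNle : (E.N (j + 1) : ℝ) ≤ E.N (i + 1) := by exact_mod_cast N_mono E hN2 (Nat.succ_le_succ hji)
    have hRle : ρ j * E.N (j + 1) ≤ ρ i * E.N (i + 1) := mul_le_mul (hρmono j hji) hNle (hN _).le (hρ0 i).le
    have h1 := dnorm_radius_le_of_one_le hn hRj hRle (fun x => E.b (j + 1) t x c')
    have h2 := hIH j hji t c' n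
    have hratio : ρ j * E.N (j + 1) / (ρ i * E.N (i + 1)) ≤ E.N (j + 1) / E.N (i + 1) := by
      rw [div_le_div_iff₀ hRf0 (hN _)]
      calc ρ j * E.N (j + 1) * E.N (i + 1) = ρ j * (E.N (j + 1) * E.N (i + 1)) := by ring
        _ ≤ ρ i * (E.N (j + 1) * E.N (i + 1)) := mul_le_mul_of_nonneg_right (hρmono j hji) (by positivity)
        _ = E.N (j + 1) * (ρ i * E.N (i + 1)) := by ring
    have hNj := (hN (j + 1)).ne'
    have hNi := (hN (i + 1)).ne'
    calc dnorm n (ρ i * E.N (i + 1)) (fun x => E.b (j + 1) t x c')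
        ≤ ρ j * E.N (j + 1) / (ρ i * E.N (i + 1)) * dnorm n (ρ j * E.N (j + 1)) (fun x => E.b (j + 1) t x c') := h1
      _ ≤ (E.N (j + 1) / E.N (i + 1)) * (Cb * E.a (j + 1) / E.N (j + 1)) :=
          mul_le_mul hratio h2 (dnorm_nonneg n hRj.le _) (by positivity)
      _ = Cb * E.a (j + 1) / E.N (i + 1) := by field_simp
  have hvec : ∀ j ∈ Finset.range (i + 1), dnorm n (ρ i * E.N (i + 1)) (E.b (j + 1) t) ≤ 3 * Cb * E.a (j + 1) / E.N (i + 1) := by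
    intro j hj
    calc dnorm n (ρ i * E.N (i + 1)) (E.b (j + 1) t) ≤ ∑ c' : Fin 3, dnorm n (ρ i * E.N (i + 1)) (fun x => E.b (j + 1) t x c') :=
          dnorm_le_sum_coord n hRf0.le (hsm j hj)
      _ ≤ ∑ _c' : Fin 3, Cb * E.a (j + 1) / E.N (i + 1) := Finset.sum_le_sum fun c' _ => hcomp j hj c'
      _ = 3 * Cb * E.a (j + 1) / E.N (i + 1) := by
          rw [Finset.sum_const, Finset.card_univ, Fintype.card_fin, nsmul_eq_mul]; push_cast; ring
  have e : E.partialSum (i + 1) t = fun x => ∑ j ∈ Finset.range (i + 1), E.b (j + 1) t x := by funext x; rfl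
  rw [e]
  calc dnorm n (ρ i * E.N (i + 1)) (fun x => ∑ j ∈ Finset.range (i + 1), E.b (j + 1) t x)
      ≤ ∑ j ∈ Finset.range (i + 1), dnorm n (ρ i * E.N (i + 1)) (E.b (j + 1) t) := dnorm_finset_sum_le_vec _ n hRf0 hsm
    _ ≤ ∑ j ∈ Finset.range (i + 1), 3 * Cb * E.a (j + 1) / E.N (i + 1) := Finset.sum_le_sum hvec
    _ = 3 * Cb * (∑ j ∈ Finset.range (i + 1), E.a (j + 1)) / E.N (i + 1) := by rw [Finset.mul_sum, Finset.sum_div]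

/-- **The window time is short**: with `C_f = 3 C_b S / N_{i+1}`, `R_f = ρ N_{i+1}`, `S = Σ_{j≤i} a_{j+1}`, the strain clause and the ceiling
`θ (i+2) ≤ 1/(36 C_b ρ)` give `s ≤ 1/(12 C_f R_f)` for every `0 ≤ s ≤ refresh (i+2)`. [cite: ArmstrongVicol2025, §2.2 (PDF p. 12: the strain constraint on τ″_m)] -/
theorem window_time_le (E : LagrangianLatticeCarrier k) (hstrain : ∀ m, E.strain m ≤ E.θ (m + 1)) (i : ℕ) {ρ Cb : ℝ} (hρ : 0 < ρ)
    (hCb : 0 < Cb) (hθ : E.θ (i + 2) ≤ 1 / (36 * Cb * ρ)) {s : ℝ} (hsR : s ≤ E.refresh (i + 2)) :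
    s ≤ 1 / (12 * (3 * Cb * (∑ j ∈ Finset.range (i + 1), E.a (j + 1)) / E.N (i + 1)) * (ρ * E.N (i + 1))) := by
  have hN : (0 : ℝ) < E.N (i + 1) := by exact_mod_cast E.N_pos (i + 1)
  set S : ℝ := ∑ j ∈ Finset.range (i + 1), E.a (j + 1) with hS
  have hS0 : 0 < S := by rw [hS]; exact Finset.sum_pos (fun j _ => E.a_pos _) ⟨0, by simp⟩
  have h12 : 12 * (3 * Cb * S / E.N (i + 1)) * (ρ * E.N (i + 1)) = 36 * Cb * ρ * S := by field_simp; norm_num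
  rw [h12]
  have hsS : s * S ≤ E.θ (i + 2) := by
    calc s * S ≤ E.refresh (i + 1 + 1) * S := mul_le_mul_of_nonneg_right hsR hS0.le
      _ = E.strain (i + 1) := by rw [mul_comm]; rfl
      _ ≤ E.θ (i + 2) := hstrain (i + 1)
  have hθ' : E.θ (i + 2) * (36 * Cb * ρ) ≤ 1 := (le_div_iff₀ (by positivity)).1 hθ
  rw [le_div_iff₀ (by positivity)]
  calc s * (36 * Cb * ρ * S) = (s * S) * (36 * Cb * ρ) := by ring
    _ ≤ E.θ (i + 2) * (36 * Cb * ρ) := mul_le_mul_of_nonneg_right hsS (by positivity)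
    _ ≤ 1 := hθ'

/-! ## §4 The window step under abstract field bounds -/

/-- **The window step.** Let `m` be a coarse level count with `⟦b_{≤m}(t)⟧_{n,R_f} ≤ C_f` (`n ≥ 1`, all `t`), and `t` a time in the window
`j` of level `m+1` whose window time `s = t − w` satisfies `s ≤ 1/(12 C_f R_f)`; let `λ = 2πΛ_W`, `C_v = (9/2) k/(2π)`. Then for every
component `c` and every order `n`: `⟦(b (m+1) t)_c⟧_{n, 13248 R_f + 183 λ N_{m+1}} ≤ 216 C_v a_{m+1}/N_{m+1}`.
[cite: ArmstrongVicol2025, App. A Prop. 7.6, Lemma 7.1, Prop. 7.11; §2.2 (PDF p. 18)] -/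
theorem window_step (E : LagrangianLatticeCarrier k) (hL : E.IsLagrangian) (hR : E.LevelRegular) (m : ℕ) (j : ℤ)
    {Cf Rf : ℝ} (hCf : 0 < Cf) (hRf : 0 < Rf) (hfb : ∀ n, 1 ≤ n → ∀ t, dnorm n Rf (E.partialSum m t) ≤ Cf)
    {s : ℝ} (hs0 : 0 ≤ s) (hsR : s < E.refresh (m + 1)) (hsT : s ≤ 1 / (12 * Cf * Rf)) (c : Fin 3) (n : ℕ) :
    dnorm n (13248 * Rf + 183 * (2 * Real.pi * ∑ l, ‖latticeVec (E.design.phase l).m‖) * E.N (m + 1))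
      (fun x => E.b (m + 1) ((j : ℝ) * E.refresh (m + 1) + s) x c) ≤ 216 * (9 / 2 * (k / (2 * Real.pi))) * (E.a (m + 1) / E.N (m + 1)) := by
  set w : ℝ := (j : ℝ) * E.refresh (m + 1) with hw
  set lam : ℝ := 2 * Real.pi * ∑ l, ‖latticeVec (E.design.phase l).m‖ with hlam
  set Cv : ℝ := 9 / 2 * (k / (2 * Real.pi)) with hCv
  have hk1 : (1 : ℝ) ≤ k := by have := E.design.pos; exact_mod_cast this
  have hCv0 : 0 < Cv := by rw [hCv]; positivity
  have hlam0 : 0 < lam := by have := one_le_sum_norm_latticeVec E.design; rw [hlam]; positivity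
  have hN : ∀ m', (0 : ℝ) < E.N m' := fun m' => by exact_mod_cast E.N_pos m'
  have ha : 0 < E.a (m + 1) := E.a_pos _
  have ht : w + s ∈ E.window (m + 1) j := by
    refine ⟨by rw [hw]; linarith, ?_⟩
    rw [hw, add_one_mul]; linarith
  have hIsF : E.IsFlow m := (hL m).1
  have hfb' : ∀ N n, 1 ≤ n → n ≤ N → ∀ t, dnorm n Rf (E.partialSum m t) ≤ Cf := fun N n hn _ t => hfb n hn t
  have hCfRfs : 24 * Cf * Rf * s ≤ 2 := by
    have h := mul_le_mul_of_nonneg_left hsT (by positivity : (0:ℝ) ≤ 24 * Cf * Rf)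
    have e : 24 * Cf * Rf * (1 / (12 * Cf * Rf)) = 2 := by field_simp; norm_num
    linarith [e ▸ h]
  -- radii
  set RJ : ℝ := 72 * Rf with hRJ
  have hRJ0 : 0 < RJ := by positivity
  have hRJ0' : 0 < 24 * Rf * (1 + 24 * Cf * Rf * s) := by positivity
  have hRJle : 24 * Rf * (1 + 24 * Cf * Rf * s) ≤ RJ := by rw [hRJ]; nlinarith [hRf]
  set RF : ℝ := RJ + lam * E.N (m + 1) with hRF
  have hRF0 : 0 < RF := by positivity
  have hRJF : RJ ≤ RF := by rw [hRF]; nlinarith [hlam0, hN (m + 1)]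
  -- (J) the flow-gradient entries at radius `RJ`
  have hJ : ∀ (a b : Fin 3) (n' : ℕ), dnorm n' RJ (fun y => (E.flowDeriv m (w + s) w y (EuclideanSpace.single b (1 : ℝ))) a) ≤ 18 := by
    intro a b n'
    rcases Nat.eq_zero_or_pos n' with rfl | hn'
    · refine (dnorm_zero_le_of_forall_norm_le hRJ0 (by norm_num) fun y => ?_).trans (by norm_num : (3:ℝ) ≤ 18)
      rw [hR.flowDeriv_single_apply, Real.norm_eq_abs]
      have h1 := abs_partialDeriv_disp_le_forward E hR hIsF j hCf hRf (N := 1) le_rfl (hfb' 1) hs0 hsR hsT b a y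
      refine (abs_add_le _ _).trans ?_
      have hδ : |(1 : Matrix (Fin 3) (Fin 3) ℝ) a b| ≤ 1 := by rw [Matrix.one_apply]; split_ifs <;> simp
      linarith
    · have h := dnorm_flowDeriv_entry_le_forward E hR hIsF j hCf hRf (hfb' (n' + 1)) hs0 hsR hsT n' hn' le_rfl a b
      exact (dnorm_anti_radius n' hRJ0' hRJle _).trans h
  -- (v) the Eulerian level at radius `RF ≥ λ N (m+1)`
  have hv : ∀ (b : Fin 3) (n' : ℕ), dnorm n' RF (fun y => E.toFractalCarrierData.level (m + 1) (w + s) y b) ≤ Cv * (E.a (m + 1) / E.N (m + 1)) := by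
    intro b n'
    have hRge : 2 * Real.pi * (E.N (m + 1) * ∑ l, ‖latticeVec (E.design.phase l).m‖) ≤ RF := by
      have : 2 * Real.pi * (E.N (m + 1) * ∑ l, ‖latticeVec (E.design.phase l).m‖) = lam * E.N (m + 1) := by rw [hlam]; ring
      rw [this, hRF]; linarith
    refine (dnorm_level_coord_le E.toFractalCarrierData (m + 1) (w + s) n' b hRge).trans (le_of_eq ?_)
    rw [hCv]; field_simp
  -- (F) products and their sum at radius `RF`
  have hJsm : ∀ a b : Fin 3, IsSmooth (fun y => (E.flowDeriv m (w + s) w y (EuclideanSpace.single b (1 : ℝ))) a) := by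
    intro a b
    simp_rw [hR.flowDeriv_single_apply]
    exact (isSmooth_const _).add (((hR.isSmooth_disp m _ _).apply a).partialDeriv b)
  have hvsm : ∀ b : Fin 3, IsSmooth (fun y => E.toFractalCarrierData.level (m + 1) (w + s) y b) := fun b =>
    (PermissibleCarrier.isSmooth_level E.toFractalCarrierData (m + 1) (w + s)).apply b
  have hpsm : ∀ b : Fin 3, IsSmooth (fun y => (E.flowDeriv m (w + s) w y (EuclideanSpace.single b (1 : ℝ))) c *
      E.toFractalCarrierData.level (m + 1) (w + s) y b) := fun b =>
    show ContDiff ℝ ∞ (fun z => lift (fun y => (E.flowDeriv m (w + s) w y (EuclideanSpace.single b (1 : ℝ))) c) z *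
      lift (fun y => E.toFractalCarrierData.level (m + 1) (w + s) y b) z) from (hJsm c b).mul (hvsm b)
  have hprod : ∀ (b : Fin 3) (n' : ℕ), dnorm n' RF
      (fun y => (E.flowDeriv m (w + s) w y (EuclideanSpace.single b (1 : ℝ))) c * E.toFractalCarrierData.level (m + 1) (w + s) y b)
        ≤ 4 * 18 * (Cv * (E.a (m + 1) / E.N (m + 1))) := fun b n' =>
    dnorm_mul_le_four (hJsm c b) (hvsm b) hRF0 (fun i _ => (dnorm_anti_radius i hRJ0 hRJF _).trans (hJ c b i)) (fun i _ => hv b i)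
  have hF : ∀ n', dnorm n' RF (fun y => ∑ b : Fin 3, (E.flowDeriv m (w + s) w y (EuclideanSpace.single b (1 : ℝ))) c *
      E.toFractalCarrierData.level (m + 1) (w + s) y b) ≤ 216 * Cv * (E.a (m + 1) / E.N (m + 1)) := by
    intro n'
    calc dnorm n' RF (fun y => ∑ b : Fin 3, (E.flowDeriv m (w + s) w y (EuclideanSpace.single b (1 : ℝ))) c *
            E.toFractalCarrierData.level (m + 1) (w + s) y b)
        ≤ ∑ b : Fin 3, dnorm n' RF (fun y => (E.flowDeriv m (w + s) w y (EuclideanSpace.single b (1 : ℝ))) c *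
            E.toFractalCarrierData.level (m + 1) (w + s) y b) := dnorm_finset_sum_le_vec _ n' hRF0 fun b _ => hpsm b
      _ ≤ ∑ _b : Fin 3, 4 * 18 * (Cv * (E.a (m + 1) / E.N (m + 1))) := Finset.sum_le_sum fun b _ => hprod b n'
      _ = 216 * Cv * (E.a (m + 1) / E.N (m + 1)) := by
          rw [Finset.sum_const, Finset.card_univ, Fintype.card_fin, nsmul_eq_mul]; push_cast; ring
  have hFsm : IsSmooth (fun y => ∑ b : Fin 3, (E.flowDeriv m (w + s) w y (EuclideanSpace.single b (1 : ℝ))) c *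
      E.toFractalCarrierData.level (m + 1) (w + s) y b) := by
    show ContDiff ℝ ∞ (fun z => lift (fun y => ∑ b : Fin 3, (E.flowDeriv m (w + s) w y (EuclideanSpace.single b (1 : ℝ))) c *
      E.toFractalCarrierData.level (m + 1) (w + s) y b) z)
    have e : (fun z => lift (fun y => ∑ b : Fin 3, (E.flowDeriv m (w + s) w y (EuclideanSpace.single b (1 : ℝ))) c *
        E.toFractalCarrierData.level (m + 1) (w + s) y b) z) = fun z => ∑ b : Fin 3,
        lift (fun y => (E.flowDeriv m (w + s) w y (EuclideanSpace.single b (1 : ℝ))) c) z *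
          lift (fun y => E.toFractalCarrierData.level (m + 1) (w + s) y b) z := by
      funext z; simp [lift_apply]
    rw [e]
    exact ContDiff.sum fun b _ => (hJsm c b).mul (hvsm b)
  -- (g) the inverse window flow `id + Dinv`, `Dinv = disp m w (w+s)`
  have hDsm : IsSmooth (E.disp m w (w + s)) := hR.isSmooth_disp m _ _
  have hD1 : IsContDiff 1 (E.disp m w (w + s)) := hDsm.isContDiff (by simp)
  have hCg0 : (0 : ℝ) < 61 / RJ := by positivity
  have hg1 : ∀ (jj : Fin 3) (y : UnitAddTorus (Fin 3)),
      4 / RJ * ‖EuclideanSpace.single jj (1 : ℝ) + partialDeriv jj (E.disp m w (w + s)) y‖ ≤ 61 / RJ := by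
    intro jj y
    have hcoord : ∀ a : Fin 3, |(EuclideanSpace.single jj (1 : ℝ) + partialDeriv jj (E.disp m w (w + s)) y) a| ≤ 3 := by
      intro a
      have h1 := abs_partialDeriv_dispInv_le E hR hIsF j hCf hRf (N := 1) le_rfl (hfb' 1) hs0 hsR hsT jj a y
      rw [partialDeriv_apply_coord hD1] at h1
      rw [PiLp.add_apply, show (EuclideanSpace.single jj (1 : ℝ) : EuclideanSpace ℝ (Fin 3)) a = if a = jj then 1 else 0 from
        PiLp.single_apply 2 ℝ jj 1 a]
      refine (abs_add_le _ _).trans ?_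
      have hδ : |(if a = jj then (1:ℝ) else 0)| ≤ 1 := by split_ifs <;> simp
      linarith
    have hnorm : ‖EuclideanSpace.single jj (1 : ℝ) + partialDeriv jj (E.disp m w (w + s)) y‖ ≤ 9 := by
      refine (norm_le_sum_abs_coord₃ _).trans ?_
      calc ∑ a : Fin 3, |(EuclideanSpace.single jj (1 : ℝ) + partialDeriv jj (E.disp m w (w + s)) y) a|
          ≤ ∑ _a : Fin 3, (3 : ℝ) := Finset.sum_le_sum fun a _ => hcoord a
        _ = 9 := by simp; norm_num
    calc 4 / RJ * ‖EuclideanSpace.single jj (1 : ℝ) + partialDeriv jj (E.disp m w (w + s)) y‖ ≤ 4 / RJ * 9 :=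
          mul_le_mul_of_nonneg_left hnorm (by positivity)
      _ = 36 / RJ := by ring
      _ ≤ 61 / RJ := div_le_div_of_nonneg_right (by norm_num) hRJ0.le
  have hg2 : ∀ n', 2 ≤ n' → dnorm n' RJ (E.disp m w (w + s)) ≤ 61 / RJ := by
    intro n' hn'
    obtain ⟨n'', rfl⟩ : ∃ n'', n' = n'' + 1 := ⟨n' - 1, by omega⟩
    have hn'' : 1 ≤ n'' := by omega
    have hent : ∀ a jj : Fin 3, dnorm n'' RJ (fun y => (1 : Matrix (Fin 3) (Fin 3) ℝ) a jj +
        partialDeriv jj (fun z => E.disp m w (w + s) z a) y) ≤ 18 := by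
      intro a jj
      have h := dnorm_dispInv_entry_le E hR hIsF j hCf hRf (hfb' (n'' + 1)) hs0 hsR hsT n'' hn'' le_rfl a jj
      exact (dnorm_anti_radius n'' hRJ0' hRJle _).trans h
    have hcoordD : ∀ a : Fin 3, dnorm (n'' + 1) RJ (fun y => E.disp m w (w + s) y a) ≤ 9 / 8 * 18 / RJ := fun a =>
      dnorm_succ_le_of_const_add_partialDeriv hn'' hRJ0 (by norm_num) (hDsm.apply a)
        (fun jj => (1 : Matrix (Fin 3) (Fin 3) ℝ) a jj) (hent a)
    calc dnorm (n'' + 1) RJ (E.disp m w (w + s)) ≤ ∑ a : Fin 3, dnorm (n'' + 1) RJ (fun y => E.disp m w (w + s) y a) :=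
          dnorm_le_sum_coord _ hRJ0.le hDsm
      _ ≤ ∑ _a : Fin 3, 9 / 8 * 18 / RJ := Finset.sum_le_sum fun a _ => hcoordD a
      _ ≤ 61 / RJ := by
          rw [Finset.sum_const, Finset.card_univ, Fintype.card_fin, nsmul_eq_mul,
            show ((3 : ℕ) : ℝ) * (9 / 8 * 18 / RJ) = (243 / 4) / RJ by push_cast; ring]
          exact div_le_div_of_nonneg_right (by norm_num) hRJ0.le
  -- (b) composition, App. A Prop. 7.6
  have hCh0 : 0 < 216 * Cv * (E.a (m + 1) / E.N (m + 1)) := mul_pos (mul_pos (by norm_num) hCv0) (div_pos ha (hN _))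
  have hcomp := ArmstrongVicol2025_composition_holds (Fin 3) (max n 1)
    (fun y => ∑ b : Fin 3, (E.flowDeriv m (w + s) w y (EuclideanSpace.single b (1 : ℝ))) c * E.toFractalCarrierData.level (m + 1) (w + s) y b)
    (E.disp m w (w + s)) (216 * Cv * (E.a (m + 1) / E.N (m + 1))) (61 / RJ) RF RJ
    hCh0 hCg0 hRF0 hRJ0 hFsm hDsm (fun n' _ => hF n') (fun _ jj y => hg1 jj y) (fun n' hn' _ => hg2 n' hn') n (le_max_left _ _)
  have hrad : RJ * (1 + (Fintype.card (Fin 3) : ℝ) * (61 / RJ) * RF) = 13248 * Rf + 183 * lam * E.N (m + 1) := by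
    rw [Fintype.card_fin, hRF, hRJ]
    field_simp
    ring
  rw [hrad] at hcomp
  have hfun : (fun x => E.b (m + 1) (w + s) x c) = fun y => (fun y => ∑ b : Fin 3,
      (E.flowDeriv m (w + s) w y (EuclideanSpace.single b (1 : ℝ))) c * E.toFractalCarrierData.level (m + 1) (w + s) y b)
        (y + proj (E.disp m w (w + s) y)) := by
    funext x
    exact b_succ_apply_eq_sum E hL hR m j ht x c
  rw [hfun]
  refine hcomp.trans (le_of_eq ?_)
  rw [hCv]

/-! ## §5 The level step -/

/-- **THE LEVEL STEP of the analytic tower.** Hypotheses: `E` Lagrangian (`IsLagrangian`) with `LevelRegular`, `2N_m ≤ N_{m+1}`, the strain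
clause; design frequency budget `λ = 2π Λ_W`; radii `ρ : ℕ → ℝ` with `0 < ρ j ≤ ρ i` for `j ≤ i`; the coarse levels satisfy
`⟦(b (j+1) t)_c⟧_{n, ρ j · N (j+1)} ≤ C_b a_{j+1}/N_{j+1}` for all `j ≤ i`, `n`, `t`, `c`, where `C_b = 216 · (9/2) k/(2π)`; the ceiling
`θ (i+2) ≤ 1/(36 C_b ρ i)`. Conclusion: `⟦(b (i+2) t)_c⟧_{n, 13248 ρ i N (i+1) + 183 λ N (i+2)} ≤ C_b a_{i+2}/N_{i+2}` for all `n`, `t`, `c`.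
[cite: ArmstrongVicol2025, App. A Prop. 7.6, Lemma 7.1, Prop. 7.11; §2.2 (PDF p. 18)] -/
theorem level_step (E : LagrangianLatticeCarrier k) (hL : E.IsLagrangian) (hR : E.LevelRegular)
    (hN2 : ∀ m, 2 * E.N m ≤ E.N (m + 1)) (hstrain : ∀ m, E.strain m ≤ E.θ (m + 1)) (i : ℕ)
    (ρ : ℕ → ℝ) (hρ0 : ∀ j, 0 < ρ j) (hρmono : ∀ j, j ≤ i → ρ j ≤ ρ i)
    (hIH : ∀ j, j ≤ i → ∀ (t : ℝ) (c : Fin 3) (n : ℕ),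
      dnorm n (ρ j * E.N (j + 1)) (fun x => E.b (j + 1) t x c) ≤ 216 * (9 / 2 * (k / (2 * Real.pi))) * (E.a (j + 1) / E.N (j + 1)))
    (hθ : E.θ (i + 2) ≤ 1 / (36 * (216 * (9 / 2 * (k / (2 * Real.pi)))) * ρ i))
    (t : ℝ) (c : Fin 3) (n : ℕ) :
    dnorm n (13248 * (ρ i * E.N (i + 1)) + 183 * (2 * Real.pi * ∑ l, ‖latticeVec (E.design.phase l).m‖) * E.N (i + 2))
      (fun x => E.b (i + 2) t x c) ≤ 216 * (9 / 2 * (k / (2 * Real.pi))) * (E.a (i + 2) / E.N (i + 2)) := by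
  set Cb : ℝ := 216 * (9 / 2 * (k / (2 * Real.pi))) with hCb
  have hk1 : (1 : ℝ) ≤ k := by have := E.design.pos; exact_mod_cast this
  have hCb0 : 0 < Cb := by rw [hCb]; positivity
  have hN : ∀ m, (0 : ℝ) < E.N m := fun m => by exact_mod_cast E.N_pos m
  -- the window of level `i+2` containing `t`
  have ht : t ∈ E.window (i + 1 + 1) ⌊t / E.refresh (i + 2)⌋ := LagrangianCarrierConstruction.mem_window_floor E (i + 2) t
  set w : ℝ := (⌊t / E.refresh (i + 2)⌋ : ℝ) * E.refresh (i + 1 + 1) with hw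
  have hs0 : 0 ≤ t - w := by have := ht.1; rw [hw]; linarith
  have hsR : t - w < E.refresh (i + 1 + 1) := by have := ht.2; rw [hw]; linarith
  -- the coarse field and the window time
  set S : ℝ := ∑ j ∈ Finset.range (i + 1), E.a (j + 1) with hS
  have hS0 : 0 < S := by rw [hS]; exact Finset.sum_pos (fun j _ => E.a_pos _) ⟨0, by simp⟩
  have hRf0 : 0 < ρ i * E.N (i + 1) := mul_pos (hρ0 i) (hN _)
  have hCf0 : 0 < 3 * Cb * S / E.N (i + 1) := div_pos (mul_pos (mul_pos (by norm_num) hCb0) hS0) (hN _)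
  have hfb : ∀ n, 1 ≤ n → ∀ t', dnorm n (ρ i * E.N (i + 1)) (E.partialSum (i + 1) t') ≤ 3 * Cb * S / E.N (i + 1) :=
    fun n hn t' => dnorm_partialSum_le E hR hN2 i ρ hρ0 hρmono
      (fun j hj t c n => by have h := hIH j hj t c n; rwa [mul_div_assoc]) hn t'
  have hsT := window_time_le E hstrain i (hρ0 i) hCb0 hθ hsR.le
  have h := window_step E hL hR (i + 1) ⌊t / E.refresh (i + 2)⌋ hCf0 hRf0 hfb hs0 hsR hsT c n
  have htw : (⌊t / E.refresh (i + 2)⌋ : ℝ) * E.refresh (i + 1 + 1) + (t - w) = t := by rw [hw]; ring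
  rw [htw] at h
  exact h

end Summit.AnomalousDissipation.AnomalousDissipation.Theorems.SolenoidalFractalHomogenisation.LagrangianCarrierAnalytic

end
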